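import Literature.RingTheory.Idempotents.PositiveInvolutionCentreBlockField
import HarnessLib

/-!
# A positive anti-involution stabilising a subalgebra induces a positive involution on EVERY presentation of a
# centre block (Mumford §21; Shimura §5.1 Prop. 5; Milne CM Prop. 1.39)

D. Mumford, *Abelian Varieties* (1970), §21, proof of Thm. 2 (p. 201): the Rosati involution «maps the centre `K`
onto itself» and is positive there; G. Shimura, *Abelian Varieties with Complex Multiplication and Modular
Functions* (1998), §5.1 Prop. 5 (p. 38): «Hence we have `Tr_{K/Q}(ξξ') > 0` for every `ξ ≠ 0` in `K`»; J. S. Milne,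
*Complex Multiplication*, Ch. I Prop. 1.39 with footnote 11 (a positive involution fixes every simple factor of a
stable commutative subalgebra).  Application of record: [Liu2021] App. D, proof of Thm. D.6 (1) (p. 140) — the Hecke
field of a block of the Hecke algebra inside `End⁰` of the Jacobian of a unitary Shimura curve.

PURE ALGEBRA, a TRANSPORT complement to ★ `PositiveInvolutionCentreBlockField`.  There (§4–§5) the block field
`Z(H)·ε` of a `τ`-stable subalgebra `H ⊆ D` at a centrally primitive idempotent `ε` is CONSTRUCTED as a number
field `R₀` with an embedding `φ` and its positive involution `ρ = φ⁻¹ ∘ τ ∘ φ`.  Here the block datum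
`(R₀, φ)` is ARBITRARY — any field `R₀` with an injective multiplicative `ℚ`-linear `φ : R₀ → D` whose image is
central in `H`, absorbed by `ε` (`φ r · ε = φ r`) and exhausts `Z(H)·ε` — for instance the datum produced WITHOUT any
involution from semisimplicity of `H`; and the conclusion is that every positive anti-endomorphism `τ` of `D`
stabilising `H` induces on THAT `R₀` a ring endomorphism `ρ` with `φ ∘ ρ = τ ∘ φ` and positive trace form:

* §1 `unop_apply_mem_range_of_block` — `τ(φ R₀) ⊆ φ R₀`: `τ(φ r) = τ(φ r · ε) = τ ε · τ(φ r) = ε · τ(φ r)` with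
  `τ ε = ε` (★ `unop_apply_eq_self_of_isCentrallyPrimitive`) and `τ(φ r) ∈ Z(H)` (★ `unop_apply_comm_of_central`),
  so `τ(φ r) ∈ Z(H)·ε = φ(R₀)`.
* §1 `exists_ringHom_trace_mul_pos_of_block` — hence (★ `exists_ringHom_trace_mul_pos_of_antiHom`) a ring
  endomorphism `ρ` of `R₀` with `φ (ρ r) = τ (φ r)`, `0 < Tr_{R₀/ℚ}(r · ρ r)` for `r ≠ 0`, `0 ≤` always.
* §2 `exists_ringHom_trace_mul_pos_of_isPositiveAntiInvolution_of_block` — the same in the currency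
  `IsPositiveAntiInvolution D ι` (`ι : D →ₗ[ℚ] D`) of `RingTheory/CentralSimple/AlbertTypes`, and the bare corollary
  `exists_ringHom_trace_mul_nonneg_of_isPositiveAntiInvolution_of_block` (`∃ ρ, ∀ r, 0 ≤ Tr(r · ρ r)`), which is
  the shape consumed by the cell's S2′ socket glue («a positive anti-involution of `End⁰(A_K)` stabilising the Hecke
  image» ⇒ «the centre-block field at `ε` carries a trace-non-negative endomorphism», at the block datum of record).

Theorems only; no definition, no named fact, no instance, no `sorry`.  Count-neutral for the cell `hodgecm-mathlib`
(HC_CM is proved only modulo the 7 printed citations until rung 0 closes).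

## References
* [MumfordAV1970] D. Mumford, *Abelian Varieties* (1970), §21: Thm. 1 and the proof of Thm. 2 (p. 201).
* [Shimura1998] G. Shimura, *Abelian Varieties with Complex Multiplication and Modular Functions* (1998), §5.1
  Proposition 5 (p. 38).
* [MilneCM2006] J. S. Milne, *Complex Multiplication* (2006/2020), Ch. I Prop. 1.39 with footnote 11 (pp. 20–21).
* [Liu2021] Y. Liu, *Fourier–Jacobi cycles and arithmetic relative trace formula*, Camb. J. Math. 9 (2021), App. D,
  proof of Thm. D.6 (1) (p. 140).
-/

noncomputable section

namespace Literature.RingTheory.Idempotents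

open Module Function

variable {D : Type*} [Ring D] [Algebra ℚ D] [Module.Finite ℚ D]
variable {R₀ : Type*} [Field R₀] [Algebra ℚ R₀] [Module.Finite ℚ R₀]

/-! ## §1 Any presentation of the centre block is `τ`-stable and inherits the positive involution -/

omit [Module.Finite ℚ R₀] in
/-- **`τ` stabilises every presentation `φ(R₀) = Z(H)·ε` of a centre block**: for a positive anti-endomorphism `τ`
of `D`, a `τ`-stable subalgebra `H`, a block `ε` of `H` and a multiplicative `ℚ`-linear `φ : R₀ → D` with image
central in `H`, absorbed by `ε` and exhausting `Z(H)·ε`, one has `τ(φ r) ∈ φ(R₀)` («maps the centre onto itself»,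
block by block, since `τ ε = ε`).
[cite: MumfordAV1970, §21 proof of Thm. 2 (p. 201)] [cite: MilneCM2006, Ch. I Prop. 1.39, footnote 11 (p. 21)] -/
theorem unop_apply_mem_range_of_block (τ : D →+* Dᵐᵒᵖ)
    (hpos : ∀ x : D, x ≠ 0 → 0 < LinearMap.trace ℚ D (Algebra.lmul ℚ D (x * (τ x).unop)))
    (H : Subalgebra ℚ D) (hH : ∀ x ∈ H, (τ x).unop ∈ H) {ε : D} (hεH : ε ∈ H)
    (hε : IsCentrallyPrimitive (⟨ε, hεH⟩ : H))
    (φ : R₀ →ₗ[ℚ] D) (hφH : ∀ r : R₀, φ r ∈ H) (hφc : ∀ r : R₀, ∀ y ∈ H, φ r * y = y * φ r)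
    (hφε : ∀ r : R₀, φ r * ε = φ r)
    (hφsurj : ∀ z ∈ H, (∀ y ∈ H, z * y = y * z) → ∃ r : R₀, φ r = z * ε) (r : R₀) :
    ∃ r' : R₀, (τ (φ r)).unop = φ r' := by
  have hτε : (τ ε).unop = ε := unop_apply_eq_self_of_isCentrallyPrimitive τ hpos H hH hεH hε
  -- `τ(φ r)` lies in `H` and is central there
  have hzH : (τ (φ r)).unop ∈ H := hH _ (hφH r)
  have hzc : ∀ y ∈ H, (τ (φ r)).unop * y = y * (τ (φ r)).unop :=
    unop_apply_comm_of_central τ hpos H hH (hφc r)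
  obtain ⟨r', hr'⟩ := hφsurj _ hzH hzc
  refine ⟨r', ?_⟩
  -- `τ(φ r) = τ(φ r · ε) = τ ε · τ(φ r) = ε · τ(φ r) = τ(φ r) · ε`
  rw [hr']
  conv_lhs => rw [← hφε r, map_mul, MulOpposite.unop_mul, hτε]
  exact (hzc ε hεH).symm

/-- **A positive anti-endomorphism induces a trace-positive ring endomorphism on EVERY presentation of a centre
block.**  Data: `τ : D → Dᵐᵒᵖ` a ring anti-endomorphism with `0 < Tr_ℚ(L_{x·τx})` for `x ≠ 0`; a `τ`-stable
subalgebra `H`; a centrally primitive idempotent `ε` of `H`; a field `R₀` finite over `ℚ` with an injective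
multiplicative `ℚ`-linear `φ : R₀ → D`, image central in `H`, `φ r · ε = φ r`, exhausting `Z(H)·ε`.  Conclusion: a
ring endomorphism `ρ` of `R₀` with `φ (ρ r) = τ (φ r)`, `0 < Tr_{R₀/ℚ}(r · ρ r)` for `r ≠ 0` and `0 ≤` always
(«Hence we have `Tr_{K/Q}(ξξ') > 0` for every `ξ ≠ 0` in `K`»).
[cite: Shimura1998, §5.1 Proposition 5 (p. 38)] [cite: MumfordAV1970, §21 proof of Thm. 2 (p. 201)]
[cite: MilneCM2006, Ch. I Prop. 1.39 (pp. 20–21)] -/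
theorem exists_ringHom_trace_mul_pos_of_block (τ : D →+* Dᵐᵒᵖ)
    (hpos : ∀ x : D, x ≠ 0 → 0 < LinearMap.trace ℚ D (Algebra.lmul ℚ D (x * (τ x).unop)))
    (H : Subalgebra ℚ D) (hH : ∀ x ∈ H, (τ x).unop ∈ H) {ε : D} (hεH : ε ∈ H)
    (hε : IsCentrallyPrimitive (⟨ε, hεH⟩ : H))
    (φ : R₀ →ₗ[ℚ] D) (hφinj : Function.Injective φ) (hφmul : ∀ a b : R₀, φ (a * b) = φ a * φ b)
    (hφH : ∀ r : R₀, φ r ∈ H) (hφc : ∀ r : R₀, ∀ y ∈ H, φ r * y = y * φ r)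
    (hφε : ∀ r : R₀, φ r * ε = φ r)
    (hφsurj : ∀ z ∈ H, (∀ y ∈ H, z * y = y * z) → ∃ r : R₀, φ r = z * ε) :
    ∃ ρ : R₀ →+* R₀, (∀ r : R₀, φ (ρ r) = (τ (φ r)).unop) ∧
      (∀ r : R₀, r ≠ 0 → 0 < Algebra.trace ℚ R₀ (r * ρ r)) ∧
      ∀ r : R₀, 0 ≤ Algebra.trace ℚ R₀ (r * ρ r) :=
  exists_ringHom_trace_mul_pos_of_antiHom τ hpos φ hφmul hφinj
    (unop_apply_mem_range_of_block τ hpos H hH hεH hε φ hφH hφc hφε hφsurj)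

/-! ## §2 The same in the currency `IsPositiveAntiInvolution` -/

open Literature.RingTheory.CentralSimple in
/-- **A positive anti-involution `ι : D →ₗ[ℚ] D` (`(xy)' = y'x'`, `x'' = x`, `0 < Tr(x'x)`) stabilising `H` induces a
trace-positive ring endomorphism on every presentation `(R₀, φ)` of the centre block `Z(H)·ε`**: `φ ∘ ρ = ι ∘ φ`,
`0 < Tr_{R₀/ℚ}(r · ρ r)` for `r ≠ 0`, `0 ≤` always.
[cite: MumfordAV1970, §21 Thm. 1 and proof of Thm. 2 (p. 201)] [cite: Shimura1998, §5.1 Proposition 5 (p. 38)]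
[cite: MilneCM2006, Ch. I Prop. 1.39 (pp. 20–21)] -/
theorem exists_ringHom_trace_mul_pos_of_isPositiveAntiInvolution_of_block {ι : D →ₗ[ℚ] D}
    (hι : IsPositiveAntiInvolution D ι) (H : Subalgebra ℚ D) (hH : ∀ x ∈ H, ι x ∈ H) {ε : D} (hεH : ε ∈ H)
    (hε : IsCentrallyPrimitive (⟨ε, hεH⟩ : H))
    (φ : R₀ →ₗ[ℚ] D) (hφinj : Function.Injective φ) (hφmul : ∀ a b : R₀, φ (a * b) = φ a * φ b)
    (hφH : ∀ r : R₀, φ r ∈ H) (hφc : ∀ r : R₀, ∀ y ∈ H, φ r * y = y * φ r)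
    (hφε : ∀ r : R₀, φ r * ε = φ r)
    (hφsurj : ∀ z ∈ H, (∀ y ∈ H, z * y = y * z) → ∃ r : R₀, φ r = z * ε) :
    ∃ ρ : R₀ →+* R₀, (∀ r : R₀, φ (ρ r) = ι (φ r)) ∧
      (∀ r : R₀, r ≠ 0 → 0 < Algebra.trace ℚ R₀ (r * ρ r)) ∧
      ∀ r : R₀, 0 ≤ Algebra.trace ℚ R₀ (r * ρ r) := by
  -- `ι` as a ring anti-endomorphism `τ : D →+* Dᵐᵒᵖ`
  let τ : D →+* Dᵐᵒᵖ :=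
    { toFun := fun x => MulOpposite.op (ι x)
      map_one' := by rw [hι.map_one]; rfl
      map_mul' := fun x y => by rw [hι.map_mul]; rfl
      map_zero' := by rw [map_zero]; rfl
      map_add' := fun x y => by rw [map_add]; rfl }
  have hτ : ∀ x, (τ x).unop = ι x := fun x => rfl
  -- positivity `0 < Tr(L_{x·ιx}) = Tr(L_{ιx·x})`
  have hpos : ∀ x : D, x ≠ 0 → 0 < LinearMap.trace ℚ D (Algebra.lmul ℚ D (x * (τ x).unop)) := by
    intro x hx
    have h := hι.trace_pos x hx
    rw [Literature.NumberTheory.Automorphic.leftMulTrace_apply, map_mul, LinearMap.trace_mul_comm, ← map_mul] at h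
    rwa [hτ]
  have hH' : ∀ x ∈ H, (τ x).unop ∈ H := fun x hx => hH x hx
  obtain ⟨ρ, hρφ, hρpos, hρnn⟩ :=
    exists_ringHom_trace_mul_pos_of_block τ hpos H hH' hεH hε φ hφinj hφmul hφH hφc hφε hφsurj
  exact ⟨ρ, fun r => (hρφ r).trans (hτ _), hρpos, hρnn⟩

open Literature.RingTheory.CentralSimple in
/-- **Socket form** — a positive anti-involution of `D` stabilising `H` makes every presentation `(R₀, φ)` of the
centre block `Z(H)·ε` carry a ring endomorphism with NON-NEGATIVE trace form, `∃ ρ, ∀ r, 0 ≤ Tr_{R₀/ℚ}(r · ρ r)`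
(the conjunct of the cell's block-field shape; with `R₀` totally complex of the right degree this is the input of
Shimura's Lemma 2 making `R₀` a CM field, ★ `ComplexMultiplication.isCMField_of_trace_mul_nonneg_over`).
[cite: Shimura1998, §5.1 Proposition 5 (p. 38)] [cite: Liu2021, App. D, proof of Thm. D.6 (1) (p. 140)] -/
theorem exists_ringHom_trace_mul_nonneg_of_isPositiveAntiInvolution_of_block {ι : D →ₗ[ℚ] D}
    (hι : IsPositiveAntiInvolution D ι) (H : Subalgebra ℚ D) (hH : ∀ x ∈ H, ι x ∈ H) {ε : D} (hεH : ε ∈ H)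
    (hε : IsCentrallyPrimitive (⟨ε, hεH⟩ : H))
    (φ : R₀ →ₗ[ℚ] D) (hφinj : Function.Injective φ) (hφmul : ∀ a b : R₀, φ (a * b) = φ a * φ b)
    (hφH : ∀ r : R₀, φ r ∈ H) (hφc : ∀ r : R₀, ∀ y ∈ H, φ r * y = y * φ r)
    (hφε : ∀ r : R₀, φ r * ε = φ r)
    (hφsurj : ∀ z ∈ H, (∀ y ∈ H, z * y = y * z) → ∃ r : R₀, φ r = z * ε) :
    ∃ ρ : R₀ →+* R₀, ∀ r : R₀, 0 ≤ Algebra.trace ℚ R₀ (r * ρ r) := by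
  obtain ⟨ρ, -, -, hρnn⟩ := exists_ringHom_trace_mul_pos_of_isPositiveAntiInvolution_of_block hι H hH hεH hε φ
    hφinj hφmul hφH hφc hφε hφsurj
  exact ⟨ρ, hρnn⟩

end Literature.RingTheory.Idempotents

end
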